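import Literature.NumberTheory.EllipticCurves.ReductionHomomorphism
import Mathlib.RingTheory.Henselian
import Mathlib.Algebra.Polynomial.Degree.SmallDegree
import HarnessLib

/-!
# Surjectivity of the reduction map `E₀(K) → Ẽ_ns(k)` over a henselian valuation ring

(Silverman, *AEC* VII.2.1.)

Sibling proof file (theorems only) of `ReductionHomomorphism.lean`, completing the exact sequence
of Silverman, *The Arithmetic of Elliptic Curves*, Prop. VII.2.1,

  `0 → E₁(K) → E₀(K) → Ẽ_ns(k) → 0`,

whose left part (subgroups, homomorphism, kernel) is proved there for a Weierstrass equation `W`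
with coefficients in any valuation ring `R` of `K`: here we prove the **surjectivity of
`E₀(K) → Ẽ_ns(k)`** when `R` is moreover *henselian* (`HenselianRing R (maximalIdeal R)`; this
covers complete discrete valuation rings through Mathlib's instance
`IsAdicComplete.henselianRing`, and `HenselianLocalRing`s), following the printed proof
(PDF p. 167): given a nonsingular point `(ᾱ, β̄)` of `W̃`, lift one coordinate arbitrarily and
solve for the other by Hensel's lemma applied to the Weierstrass polynomial in the remaining
variable, which has a *simple* root modulo `𝔪` because `∂f̃/∂y (ᾱ, β̄) ≠ 0`, resp.
`∂f̃/∂x (ᾱ, β̄) ≠ 0`.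

* `WeierstrassCurve.exists_reducePoint_eq` — every point of `Ẽ_ns(k) = W̃.toAffine.Point` is the
  reduction of a point of `E₀(K)`;
* `WeierstrassCurve.reductionHom_surjective` — the bundled form.

## References

* J. H. Silverman, *The Arithmetic of Elliptic Curves*, 2nd ed. (2009), VII.2 Prop. 2.1, first
  paragraph of the proof (PDF p. 167). [SilvermanAEC2009]

## Design

No definitions, no `sorry`; `noncomputable section`, `open scoped Classical`.
-/

noncomputable section

open scoped Classical

open Polynomial

namespace WeierstrassCurve

variable {K : Type*} [Field K] {Γ₀ : Type*} [LinearOrderedCommGroupWithZero Γ₀]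
  {v : Valuation K Γ₀} {R : Type*} [CommRing R] [IsLocalRing R] [Algebra R K]
  [HenselianRing R (IsLocalRing.maximalIdeal R)] (W : WeierstrassCurve R)

/-- **Hensel lift of a nonsingular point of the reduction** (Silverman, *AEC* VII.2.1, proof of
surjectivity): over a henselian local ring `R`, every nonsingular point `(ᾱ, β̄)` of
`W̃ = W mod 𝔪` lifts to a point `(a, b)` of `W` with coordinates in `R`, `ā = ᾱ`, `b̄ = β̄`.
[cite: SilvermanAEC2009, VII.2 Prop. 2.1, proof (PDF p. 167)] -/
theorem exists_equation_residue_eq {α β : IsLocalRing.ResidueField R}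
    (hns : (W.map (IsLocalRing.residue R)).toAffine.Nonsingular α β) :
    ∃ a b : R, W.toAffine.Equation a b ∧ IsLocalRing.residue R a = α ∧
      IsLocalRing.residue R b = β := by
  obtain ⟨a₀, rfl⟩ := IsLocalRing.residue_surjective α
  obtain ⟨b₀, rfl⟩ := IsLocalRing.residue_surjective β
  obtain ⟨heq, hder⟩ := hns
  rw [WeierstrassCurve.Affine.equation_iff] at heq
  simp only [map_a₁, map_a₂, map_a₃, map_a₄, map_a₆] at heq
  rw [WeierstrassCurve.Affine.evalEval_polynomialX, WeierstrassCurve.Affine.evalEval_polynomialY]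
    at hder
  simp only [map_a₁, map_a₂, map_a₃, map_a₄] at hder
  -- the Weierstrass polynomial at `(a₀, b₀)` lies in `𝔪`
  have hval : b₀ ^ 2 + W.a₁ * a₀ * b₀ + W.a₃ * b₀ - (a₀ ^ 3 + W.a₂ * a₀ ^ 2 + W.a₄ * a₀ + W.a₆)
      ∈ IsLocalRing.maximalIdeal R := by
    rw [← IsLocalRing.residue_eq_zero_iff]
    simp only [map_sub, map_add, map_mul, map_pow]
    exact sub_eq_zero.mpr heq
  by_cases hY : 2 * IsLocalRing.residue R b₀ + IsLocalRing.residue R W.a₁ * IsLocalRing.residue R a₀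
      + IsLocalRing.residue R W.a₃ ≠ 0
  · -- `∂f̃/∂y ≠ 0`: solve for `y` with `x = a₀`
    set f : R[X] := X ^ 2 + (C (W.a₁ * a₀ + W.a₃) * X +
      C (-(a₀ ^ 3 + W.a₂ * a₀ ^ 2 + W.a₄ * a₀ + W.a₆))) with hf
    have hmonic : f.Monic := (monic_X_pow 2).add_of_left
      (degree_linear_le.trans_lt (by rw [degree_X_pow]; exact WithBot.coe_lt_coe.mpr one_lt_two))
    have heval : ∀ b : R, f.eval b =
        b ^ 2 + W.a₁ * a₀ * b + W.a₃ * b - (a₀ ^ 3 + W.a₂ * a₀ ^ 2 + W.a₄ * a₀ + W.a₆) := by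
      intro b; simp only [hf, eval_add, eval_pow, eval_X, eval_mul, eval_C]; ring
    have hderiv : f.derivative.eval b₀ = 2 * b₀ + W.a₁ * a₀ + W.a₃ := by
      simp only [hf, derivative_add, derivative_X_pow, derivative_mul, derivative_C, derivative_X,
        eval_add, eval_mul, eval_C, eval_X, eval_pow, eval_zero, eval_one]
      ring
    have hunit :
        IsUnit (Ideal.Quotient.mk (IsLocalRing.maximalIdeal R) (f.derivative.eval b₀)) := by
      refine IsUnit.map _ ?_
      rw [hderiv]
      exact Literature.NumberTheory.EllipticCurves.isUnit_of_residue_ne_zero (by simpa only [map_add, map_mul, map_ofNat] using hY)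
    obtain ⟨b, hb, hbb₀⟩ :=
      HenselianRing.is_henselian f hmonic b₀ (by rw [heval]; exact hval) hunit
    refine ⟨a₀, b, ?_, rfl, ?_⟩
    · rw [WeierstrassCurve.Affine.equation_iff, ← sub_eq_zero, ← heval]; exact hb
    · rw [← sub_eq_zero, ← map_sub, IsLocalRing.residue_eq_zero_iff]; exact hbb₀
  · -- `∂f̃/∂y = 0`, hence `∂f̃/∂x ≠ 0`: solve for `x` with `y = b₀`
    rw [not_not] at hY
    have hX : IsLocalRing.residue R W.a₁ * IsLocalRing.residue R b₀ -
        (3 * IsLocalRing.residue R a₀ ^ 2 +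
          2 * IsLocalRing.residue R W.a₂ * IsLocalRing.residue R a₀ + IsLocalRing.residue R W.a₄)
          ≠ 0 := hder.resolve_right (fun h ↦ h hY)
    set g : R[X] := X ^ 3 + (C W.a₂ * X ^ 2 + C (W.a₄ - W.a₁ * b₀) * X +
      C (W.a₆ - b₀ ^ 2 - W.a₃ * b₀)) with hg
    have hmonic : g.Monic := (monic_X_pow 3).add_of_left
      (degree_quadratic_le.trans_lt
        (by rw [degree_X_pow]; exact WithBot.coe_lt_coe.mpr (by norm_num)))
    have heval : ∀ a : R, g.eval a =
        -(b₀ ^ 2 + W.a₁ * a * b₀ + W.a₃ * b₀ - (a ^ 3 + W.a₂ * a ^ 2 + W.a₄ * a + W.a₆)) := by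
      intro a; simp only [hg, eval_add, eval_pow, eval_X, eval_mul, eval_C]; ring
    have hderiv : g.derivative.eval a₀ = 3 * a₀ ^ 2 + 2 * W.a₂ * a₀ + W.a₄ - W.a₁ * b₀ := by
      simp only [hg, derivative_add, derivative_X_pow, derivative_mul, derivative_C, derivative_X,
        eval_add, eval_mul, eval_C, eval_X, eval_pow, eval_zero, eval_one]
      ring
    have hunit :
        IsUnit (Ideal.Quotient.mk (IsLocalRing.maximalIdeal R) (g.derivative.eval a₀)) := by
      refine IsUnit.map _ ?_
      rw [hderiv]
      refine Literature.NumberTheory.EllipticCurves.isUnit_of_residue_ne_zero ?_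
      simp only [map_add, map_sub, map_mul, map_pow, map_ofNat]
      intro h; apply hX; linear_combination -h
    obtain ⟨a, ha, haa₀⟩ :=
      HenselianRing.is_henselian g hmonic a₀ (by rw [heval]; exact neg_mem hval) hunit
    refine ⟨a, b₀, ?_, ?_, rfl⟩
    · rw [WeierstrassCurve.Affine.equation_iff, ← sub_eq_zero, ← neg_eq_zero, ← heval]; exact ha
    · rw [← sub_eq_zero, ← map_sub, IsLocalRing.residue_eq_zero_iff]; exact haa₀

omit [HenselianRing R (IsLocalRing.maximalIdeal R)] in
/-- A point of `W` with coordinates in `R` and nonsingular reduction is a nonsingular point of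
`W.baseChange K`. [folklore] -/
theorem nonsingular_baseChange_of_nonsingular_residue {a b : R} (heq : W.toAffine.Equation a b)
    (hns : (W.map (IsLocalRing.residue R)).toAffine.Nonsingular (IsLocalRing.residue R a)
      (IsLocalRing.residue R b)) :
    (W.baseChange K).toAffine.Nonsingular (algebraMap R K a) (algebraMap R K b) := by
  refine ⟨heq.map (algebraMap R K), ?_⟩
  rw [WeierstrassCurve.Affine.evalEval_polynomialX, WeierstrassCurve.Affine.evalEval_polynomialY,
    Literature.NumberTheory.EllipticCurves.baseChange_a₁, Literature.NumberTheory.EllipticCurves.baseChange_a₂, Literature.NumberTheory.EllipticCurves.baseChange_a₃, Literature.NumberTheory.EllipticCurves.baseChange_a₄]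
  have hder := hns.2
  rw [WeierstrassCurve.Affine.evalEval_polynomialX, WeierstrassCurve.Affine.evalEval_polynomialY]
    at hder
  simp only [map_a₁, map_a₂, map_a₃, map_a₄] at hder
  -- a unit of `R` is non-zero in `K`
  have key : ∀ d : R, IsLocalRing.residue R d ≠ 0 → algebraMap R K d ≠ 0 := fun d hd ↦
    ((Literature.NumberTheory.EllipticCurves.isUnit_of_residue_ne_zero hd).map (algebraMap R K)).ne_zero
  rcases hder with h | h
  · left
    have := key (W.a₁ * b - (3 * a ^ 2 + 2 * W.a₂ * a + W.a₄))
      (by simpa only [map_sub, map_add, map_mul, map_pow, map_ofNat] using h)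
    simpa only [map_sub, map_add, map_mul, map_pow, map_ofNat] using this
  · right
    have := key (2 * b + W.a₁ * a + W.a₃)
      (by simpa only [map_add, map_mul, map_ofNat] using h)
    simpa only [map_add, map_mul, map_ofNat] using this

/-- **Surjectivity of reduction `E₀(K) → Ẽ_ns(k)`** (Silverman, *AEC* VII.2.1, for `K` complete;
here for any henselian valuation ring `R` of `K`): every point of `Ẽ_ns(k)` is the reduction of a
point of `E₀(K)` with coordinates in `R`. [cite: SilvermanAEC2009, VII.2 Prop. 2.1 (PDF p. 167)] -/
theorem exists_reducePoint_eq (hinj : Function.Injective (algebraMap R K))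
    (Q : (W.map (IsLocalRing.residue R)).toAffine.Point) :
    ∃ P : (W.baseChange K).toAffine.Point, W.HasNonsingularReduction P ∧ W.reducePoint P = Q := by
  rcases Q with _ | ⟨α, β, hns⟩
  · exact ⟨0, trivial, rfl⟩
  obtain ⟨a, b, heq, rfl, rfl⟩ := W.exists_equation_residue_eq hns
  have h := W.nonsingular_baseChange_of_nonsingular_residue (K := K) heq hns
  exact ⟨.some _ _ h, (hasNonsingularReduction_some_algebraMap_iff hinj h).mpr hns,
    reducePoint_some_algebraMap hinj h hns⟩

/-- **Exactness on the right** of `0 → E₁(K) → E₀(K) → Ẽ_ns(k) → 0` (Silverman, *AEC* VII.2.1):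
for a henselian valuation ring the reduction homomorphism `WeierstrassCurve.reductionHom` is
surjective. [cite: SilvermanAEC2009, VII.2 Prop. 2.1 (PDF p. 167)] -/
theorem reductionHom_surjective (hv : v.Integers R) :
    Function.Surjective (W.reductionHom hv) := by
  intro Q
  obtain ⟨P, hP, hPQ⟩ := W.exists_reducePoint_eq hv.hom_inj Q
  exact ⟨⟨P, hP⟩, hPQ⟩

end WeierstrassCurve
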